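import Mathlib
import HarnessLib
import Summits.KontsevichZagierPeriods.Zeta5Search.Denom.CatalanRayPClosedOdd

/-!
# CatalanRayPClosedTwo — the prime 2 for the explicit rational part `PClosed`: 2-adic toolkit, coefficient valuations, atom bounds (cell `pub-zeta5`, fam-denom D9b)

HONEST FRAMING: systematic search; no irrationality claim unless certified.  This file is denominator arithmetic of
an explicit finite sum of rationals; it makes no statement about irrationality.

`Denom/CatalanRayPClosed.lean` + `CatalanRayPClosedOdd.lean` (fam-denom D9): for the explicit rational part `PClosed n J`
of the slid partial-fraction representation of the Catalan ray forms (`CATK6.md` §1, `L′ = n`), Theorem K6 (odd part)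
is proved: `v_p(PClosed n J) ≥ −(⌊log_p(J+n)⌋ + ⌊log_p max(J,4n−1)⌋)` for every odd prime `p` (`J ≥ 3n ≥ 3`).
Here and in `CatalanRayPClosedInt.lean` (fam-denom D9b) — THIS file = the 2-adic toolkit (crude Legendre `v₂(k!) ≤ k`,
`v₂((2K)!) = K + v₂(K!)`, `v₂ C(2k,k)`, the blocks `v2_K0 / v2_Nnum_* / v2_tB`), the exact `v2_coef_alpha/beta/gamma`, the
2-adic atom bounds and the prime-generic `Λ` bound `logDer_padicValRat_ge'` with `log_two_window`; the NEXT file = the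
term bounds, `PClosed_twoInt` and the packaging:

* `PClosed_twoInt` — the 2-adic half: `v₂(PClosed n J) ≥ −(4J + 2n)` (`J ≥ 3n ≥ 3`); on the ray `J = jn` this is
  `2^{2(2j+1)n} · P ∈ ℤ_(2)`, the exponent of fam-catalan's `rayMult`.  The proof is termwise with crude Legendre
  bookkeeping only (`0 ≤ v₂(k!) ≤ k`, `v₂((2k)!) = k + v₂(k!)`), the 2-adic atom bounds `v₂(σ_a) ≥ −2a`,
  `v₂(gsum_c) ≥ −1`, `v₂(W_a) ≥ −3a`, `v₂(Λ_a) ≥ −⌊log₂(2(a+J)−1)⌋ ≥ −(J+1)`; per term: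
  `v₂(termA c) ≥ −2J−4n−2c+2`, `v₂(termBB a) ≥ −2J−4n−2a`, `v₂(termBA a) ≥ −3J−4n−a`, `v₂(termG a) ≥ −2J−3n−2a+1`,
  each `≥ −(4J+2n)` when `J ≥ 3n` (numerically the true slack is ≥ 5 on j = 4..8, n ≤ 5: `d9/pclosed.py two`).
* `dstarOdd N = ∏_{p odd prime ≤ N} p^{⌊log_p N⌋}` (same definition as fam-catalan's `CatalanTwoAdicRay.dstarOdd`),
  `padicValRat_dstarOdd` (`v_p = ⌊log_p N⌋` for odd `p`), `exists_int_of_padicValRat_nonneg` (a rational with all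
  `v_p ≥ 0` is an integer), and the packaging
  `PClosed_isInt : ∃ z : ℤ, z = d*_{J+n} · d*_{max(J,4n−1)} · 2^{4J+2n} · PClosed n J`,
  `rayPClosed_isInt (j ≥ 4) : ∃ z : ℤ, z = d*_{(j+1)n} · d*_{jn} · 2^{2(2j+1)n} · rayPClosed j n`
  — i.e. `rayMult j n · P ∈ ℤ` in fam-catalan's currency, for the closed form.  What is NOT typed: the identification
  of `rayPClosed j n` with the remainder `P_n` of `Jsym n (jn) n ((j+1)n) n = Q_n G + P_n` (analytic node).
-/


namespace Summit.KontsevichZagierPeriods.Zeta5Search.Denom.CatalanRayPClosed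

open Finset
open Summit.KontsevichZagierPeriods.Zeta5Search.Denom.CatalanRayAtoms
open Summit.KontsevichZagierPeriods.Zeta5Search.Denom.CatalanRayDigits

/-! ### 2-adic toolkit -/

/-- `v₂(2) = 1`, `v₂(4) = 2`, `v₂(8) = 3` (bundled). -/
theorem v2_small : padicValRat 2 (2 : ℚ) = 1 ∧ padicValRat 2 (4 : ℚ) = 2 ∧ padicValRat 2 (8 : ℚ) = 3 := by
  refine ⟨?_, ?_, ?_⟩
  · rw [show (2 : ℚ) = ((2 : ℕ) : ℚ) by norm_num, padicValRat.of_nat, padicValNat_self, Nat.cast_one]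
  · rw [show (4 : ℚ) = ((2 ^ 2 : ℕ) : ℚ) by norm_num, padicValRat.of_nat, padicValNat.prime_pow]; norm_num
  · rw [show (8 : ℚ) = ((2 ^ 3 : ℕ) : ℚ) by norm_num, padicValRat.of_nat, padicValNat.prime_pow]; norm_num

/-- `v₂(4^i) = 2i`. -/
theorem padicValNat_two_four_pow (i : ℕ) : padicValNat 2 (4 ^ i) = 2 * i := by
  rw [show (4 : ℕ) = 2 ^ 2 by norm_num, ← pow_mul, padicValNat.prime_pow]

/-- `v₂(odd) = 0`. -/
theorem padicValNat_two_odd (i : ℕ) : padicValNat 2 (2 * i + 1) = 0 :=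
  padicValNat.eq_zero_of_not_dvd (by omega)

/-- `v₂((2z+1)/2) = −1` for an integer `z`. -/
theorem v2_halfodd_int (z : ℤ) : padicValRat 2 ((((2 * z + 1 : ℤ)) : ℚ) / 2) = -1 := by
  have hz : (((2 * z + 1 : ℤ)) : ℚ) ≠ 0 := by exact_mod_cast (show (2 * z + 1 : ℤ) ≠ 0 by omega)
  rw [padicValRat.div hz two_ne_zero, padicValRat.of_int, v2_small.1,
    padicValInt.eq_zero_of_not_dvd (by omega : ¬ ((2 : ℕ) : ℤ) ∣ 2 * z + 1)]
  norm_num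

/-- Legendre at `2`, crude form: `v₂(k!) ≤ k`. -/
theorem vf_two_le (k : ℕ) : vf 2 k ≤ (k : ℤ) := by
  unfold vf
  have h : (2 - 1) * padicValNat 2 (k.factorial) = k - (Nat.digits 2 k).sum := sub_one_mul_padicValNat_factorial k
  have h' : padicValNat 2 k.factorial ≤ k := by omega
  exact_mod_cast h'

/-- `v₂(k!) ≥ 0`. -/
theorem vf_nonneg (p k : ℕ) : 0 ≤ vf p k := by unfold vf; positivity

/-- `v₂((2K)!) = K + v₂(K!)` (`(2K)! = 2^K K! (2K−1)!!`). -/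
theorem twoBlock (K : ℕ) : vf 2 (2 * K) = K + vf 2 K := by
  unfold vf
  induction K with
  | zero => simp
  | succ K ih =>
    have e1 : (2 * (K + 1)).factorial = (2 * K).factorial * (2 * K + 1) * (2 * (K + 1)) := by
      rw [show 2 * (K + 1) = (2 * K + 1) + 1 by ring, Nat.factorial_succ, Nat.factorial_succ]; ring
    have e2 : padicValNat 2 (2 * (K + 1)).factorial
        = padicValNat 2 (2 * K).factorial + padicValNat 2 (2 * K + 1) + (1 + padicValNat 2 (K + 1)) := by
      rw [e1, padicValNat.mul (by positivity) (by omega), padicValNat.mul (by positivity) (by omega),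
        padicValNat.mul (by norm_num) (by omega), padicValNat_self]
    rw [e2, padicValNat_two_odd, Nat.factorial_succ, padicValNat.mul (by omega) (Nat.factorial_ne_zero K)]
    push_cast at ih ⊢
    linarith

/-- `v₂(C(2k,k)) = v₂((2k)!) − 2v₂(k!) = k − v₂(k!)`; in particular `0 ≤ v₂(C(2k,k)) ≤ k`. -/
theorem v2_centralBinom (k : ℕ) : ((padicValNat 2 (Nat.choose (2 * k) k) : ℕ) : ℤ) = k - vf 2 k := by
  have h := Nat.choose_mul_factorial_mul_factorial (show k ≤ 2 * k by omega)
  rw [show 2 * k - k = k by omega] at h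
  have hv : padicValNat 2 (Nat.choose (2 * k) k) + padicValNat 2 k.factorial + padicValNat 2 k.factorial
      = padicValNat 2 (2 * k).factorial := by
    rw [← padicValNat.mul (Nat.choose_pos (by omega)).ne' (Nat.factorial_ne_zero k),
      ← padicValNat.mul (mul_ne_zero (Nat.choose_pos (by omega)).ne' (Nat.factorial_ne_zero k))
        (Nat.factorial_ne_zero k), h]
  have hb := twoBlock k
  unfold vf at hb ⊢
  have hv' : ((padicValNat 2 (Nat.choose (2 * k) k) : ℕ) : ℤ) + (padicValNat 2 k.factorial : ℕ)
      + (padicValNat 2 k.factorial : ℕ) = (padicValNat 2 (2 * k).factorial : ℕ) := by exact_mod_cast hv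
  linarith

/-- `v₂((½)_n) = −n`. -/
theorem v2_K0 (n : ℕ) : padicValRat 2 (K0 n) = -(n : ℤ) := by
  unfold K0
  rw [← padicValRat_prod (fun i _ => by positivity)]
  have hs : ∀ i ∈ range n, padicValRat 2 ((1 : ℚ) / 2 + (i : ℕ)) = -1 := by
    intro i _
    rw [show (1 : ℚ) / 2 + (i : ℕ) = (((2 * (i : ℤ) + 1 : ℤ)) : ℚ) / 2 by push_cast; ring]
    exact v2_halfodd_int _
  rw [Finset.sum_congr rfl hs]; simp

/-- `v₂(N(d)) = −(J+n)` at every integer `d` (all factors are half-odd integers). -/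
theorem v2_Nnum_int (n J : ℕ) (d : ℤ) : padicValRat 2 (Nnum n J (d : ℚ)) = -((J + n : ℕ) : ℤ) := by
  unfold Nnum
  have hfac : ∀ i ∈ range (J + n),
      ((d : ℚ) - J + 1 / 2 + (i : ℕ)) = (((2 * (d - J + i) + 1 : ℤ)) : ℚ) / 2 := by
    intro i _; push_cast; ring
  rw [← padicValRat_prod (fun i hi => by
    rw [hfac i hi]
    exact div_ne_zero (by exact_mod_cast (show (2 * (d - J + i) + 1 : ℤ) ≠ 0 by omega)) two_ne_zero)]
  rw [Finset.sum_congr rfl (fun i hi => by rw [hfac i hi, v2_halfodd_int])]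
  simp

/-- `v₂(N(c)) = −(J+n)` at `d = c ∈ ℕ`. -/
theorem v2_Nnum_nat (n J c : ℕ) : padicValRat 2 (Nnum n J (c : ℚ)) = -((J + n : ℕ) : ℤ) := by
  have h := v2_Nnum_int n J (c : ℤ)
  rwa [Int.cast_natCast] at h

/-- `v₂(N(−a)) = −(J+n)` at `d = −a`. -/
theorem v2_Nnum_neg (n J a : ℕ) : padicValRat 2 (Nnum n J (-(a : ℚ))) = -((J + n : ℕ) : ℤ) := by
  have h := v2_Nnum_int n J (-(a : ℤ))
  push_cast at h
  exact h

/-- `v₂(t_b) = 2b + 1 + 2v₂(b!) − v₂((2b+1)!)` (`t_b = tB (b+1) = 2·4^b (b!)²/(2b+1)!`). -/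
theorem v2_tB (b : ℕ) : padicValRat 2 (tB (b + 1)) = 2 * b + 1 + 2 * vf 2 b - vf 2 (2 * b + 1) := by
  unfold tB vf
  rw [show b + 1 - 1 = b by omega, show 2 * (b + 1) - 1 = 2 * b + 1 by omega]
  have hf1 : ((b.factorial : ℕ) : ℚ) ≠ 0 := by positivity
  have hf2 : (((2 * b + 1).factorial : ℕ) : ℚ) ≠ 0 := by positivity
  have h4 : ((4 : ℚ)) ^ b ≠ 0 := by positivity
  rw [padicValRat.div (by positivity) hf2, padicValRat.mul (by positivity) (pow_ne_zero 2 hf1),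
    padicValRat.mul two_ne_zero h4, padicValRat.pow, padicValRat.pow, padicValRat.of_nat, padicValRat.of_nat,
    v2_small.1, v2_small.2.1]
  push_cast; ring

/-! ### 2-adic coefficient valuations -/

/-- α (`J = m + c`, `n ≤ m`): `v₂(A_c)`. -/
theorem v2_coef_alpha (n m c : ℕ) (hmn : n ≤ m) :
    padicValRat 2 (coef n (m + c) c)
      = (-(n : ℤ) + -((m + c + n : ℕ) : ℤ)) - ((vf 2 (m - n) + vf 2 (c + n)) + (vf 2 (c + 2 * n) - vf 2 c)) := by
  unfold coef
  rw [padicValRat.div (mul_ne_zero (K0_ne n) (Nnum_alpha_ne n m c)) (mul_ne_zero (D1_ne _ _ _) (D2_ne _ _)),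
    padicValRat.mul (K0_ne n) (Nnum_alpha_ne n m c), padicValRat.mul (D1_ne _ _ _) (D2_ne _ _),
    v2_K0, v2_Nnum_nat, v_D1_alpha n m c hmn, v_D2_alpha]

/-- β (`1 ≤ a ≤ n ≤ a + J`): `v₂(B_a)`. -/
theorem v2_coef_beta (n J a : ℕ) (ha1 : 1 ≤ a) (ha : a ≤ n) (hn : n ≤ a + J) :
    padicValRat 2 (coef n J (-(a : ℚ)))
      = (-(n : ℤ) + -((J + n : ℕ) : ℤ))
        - ((vf 2 (a + J - n) + vf 2 (n - a)) + (vf 2 (a - 1) + vf 2 (2 * n - a))) := by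
  unfold coef
  rw [padicValRat.div (mul_ne_zero (K0_ne n) (Nnum_neg_ne n J a)) (mul_ne_zero (D1_ne _ _ _) (D2_ne _ _)),
    padicValRat.mul (K0_ne n) (Nnum_neg_ne n J a), padicValRat.mul (D1_ne _ _ _) (D2_ne _ _),
    v2_K0, v2_Nnum_neg, v_D1_beta n J a ha hn, v_D2_neg n a ha1 (by omega)]

/-- γ (`n < a ≤ 2n`): `v₂(A_a)`. -/
theorem v2_coef_gamma (n J a : ℕ) (hna : n < a) (ha2 : a ≤ 2 * n) :
    padicValRat 2 (coef n J (-(a : ℚ)))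
      = (-(n : ℤ) + -((J + n : ℕ) : ℤ))
        - ((vf 2 (a + J - n) - vf 2 (a - n - 1)) + (vf 2 (a - 1) + vf 2 (2 * n - a))) := by
  unfold coef
  rw [padicValRat.div (mul_ne_zero (K0_ne n) (Nnum_neg_ne n J a)) (mul_ne_zero (D1_ne _ _ _) (D2_ne _ _)),
    padicValRat.mul (K0_ne n) (Nnum_neg_ne n J a), padicValRat.mul (D1_ne _ _ _) (D2_ne _ _),
    v2_K0, v2_Nnum_neg, v_D1_gamma n J a hna, v_D2_neg n a (by omega) ha2]

/-! ### 2-adic atom bounds -/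

/-- `v₂(C(2i,i)/(4^i(2i+1))) ≥ −2i`. -/
theorem sigmaTerm_two_ge (i : ℕ) :
    -(2 * (i : ℤ)) ≤ padicValRat 2 ((Nat.choose (2 * i) i : ℚ) / ((4 ^ i * (2 * i + 1) : ℕ) : ℚ)) := by
  have hC : Nat.choose (2 * i) i ≠ 0 := (Nat.choose_pos (by omega)).ne'
  have hD : (4 ^ i * (2 * i + 1) : ℕ) ≠ 0 := by positivity
  have hCq : (Nat.choose (2 * i) i : ℚ) ≠ 0 := by exact_mod_cast hC
  have hDq : ((4 ^ i * (2 * i + 1) : ℕ) : ℚ) ≠ 0 := by exact_mod_cast hD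
  rw [padicValRat.div hCq hDq, padicValRat.of_nat, padicValRat.of_nat,
    padicValNat.mul (by positivity) (by omega), padicValNat_two_four_pow, padicValNat_two_odd, add_zero]
  have h2 : (0 : ℤ) ≤ ((padicValNat 2 (Nat.choose (2 * i) i) : ℕ) : ℤ) := by positivity
  push_cast at h2 ⊢
  linarith

/-- **2-adic atom (σ)**: `v₂(σ(a)) ≥ −2a`. -/
theorem sigmaAtom_two_ge (a : ℕ) : -(2 * (a : ℤ)) ≤ padicValRat 2 (sigmaAtom a) := by
  unfold sigmaAtom
  apply le_padicValRat_sum _ _ _ (by linarith)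
  intro i hi
  rw [Finset.mem_range] at hi
  have h := sigmaTerm_two_ge i
  have : (i : ℤ) ≤ a := by exact_mod_cast hi.le
  linarith

/-- `v₂(4^μ/(2(2μ+1)²C(2μ,μ))) = 2μ − 1 − v₂(C(2μ,μ)) ≥ μ − 1 ≥ −1`. -/
theorem gsumTerm_two_ge (μ : ℕ) :
    (-1 : ℤ) ≤ padicValRat 2 (((4 ^ μ : ℕ) : ℚ) / ((2 * (2 * μ + 1) ^ 2 * Nat.choose (2 * μ) μ : ℕ) : ℚ)) := by
  have hC : Nat.choose (2 * μ) μ ≠ 0 := (Nat.choose_pos (by omega)).ne'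
  have hN : (4 ^ μ : ℕ) ≠ 0 := by positivity
  have hD : (2 * (2 * μ + 1) ^ 2 * Nat.choose (2 * μ) μ : ℕ) ≠ 0 := by positivity
  have hNq : ((4 ^ μ : ℕ) : ℚ) ≠ 0 := by exact_mod_cast hN
  have hDq : ((2 * (2 * μ + 1) ^ 2 * Nat.choose (2 * μ) μ : ℕ) : ℚ) ≠ 0 := by exact_mod_cast hD
  rw [padicValRat.div hNq hDq, padicValRat.of_nat, padicValRat.of_nat, padicValNat_two_four_pow,
    padicValNat.mul (by positivity) hC, padicValNat.mul (by norm_num) (by positivity), padicValNat_self,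
    padicValNat.pow (2 * μ + 1) 2, padicValNat_two_odd, mul_zero, add_zero]
  have hc := v2_centralBinom μ
  have h0 := vf_nonneg 2 μ
  push_cast at hc ⊢
  linarith

/-- **2-adic atom (gsum)**: `v₂(gsum(c)) ≥ −1`. -/
theorem gsumAtom_two_ge (c : ℕ) : (-1 : ℤ) ≤ padicValRat 2 (gsumAtom c) := by
  unfold gsumAtom
  exact le_padicValRat_sum _ _ _ (by norm_num) (fun μ _ => gsumTerm_two_ge μ)

/-- `v₂(8C(2b,b)/(4^b(2b+1)²)) = 3 + v₂(C) − 2b ≥ −3b`. -/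
theorem wInc₁_two_ge (b : ℕ) : -(3 * (b : ℤ)) ≤ padicValRat 2 (wInc₁ b) := by
  unfold wInc₁
  have hC : Nat.choose (2 * b) b ≠ 0 := (Nat.choose_pos (by omega)).ne'
  have hN : (8 * Nat.choose (2 * b) b : ℕ) ≠ 0 := by positivity
  have hD : (4 ^ b * (2 * b + 1) ^ 2 : ℕ) ≠ 0 := by positivity
  have hNq : ((8 * Nat.choose (2 * b) b : ℕ) : ℚ) ≠ 0 := by exact_mod_cast hN
  have hDq : ((4 ^ b * (2 * b + 1) ^ 2 : ℕ) : ℚ) ≠ 0 := by exact_mod_cast hD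
  rw [padicValRat.div hNq hDq, padicValRat.of_nat, padicValRat.of_nat, padicValNat.mul (by norm_num) hC,
    show (8 : ℕ) = 2 ^ 3 by norm_num, padicValNat.prime_pow, padicValNat.mul (by positivity) (by positivity),
    padicValNat_two_four_pow, padicValNat.pow (2 * b + 1) 2, padicValNat_two_odd, mul_zero, add_zero]
  have h2 : (0 : ℤ) ≤ ((padicValNat 2 (Nat.choose (2 * b) b) : ℕ) : ℤ) := by positivity
  push_cast at h2 ⊢
  linarith

/-- `v₂(2σ(b)/(b(2b+1))) = 1 + v₂(σ(b)) − v₂(b) ≥ 1 − 2b − b ≥ −3b` (`b ≥ 1`). -/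
theorem wInc₂_two_ge (b : ℕ) (hb : 1 ≤ b) : -(3 * (b : ℤ)) ≤ padicValRat 2 (wInc₂ b) := by
  unfold wInc₂
  have hσ : sigmaAtom b ≠ 0 := (sigmaAtom_pos b hb).ne'
  have hD : (b * (2 * b + 1) : ℕ) ≠ 0 := by positivity
  have hDq : ((b * (2 * b + 1) : ℕ) : ℚ) ≠ 0 := by exact_mod_cast hD
  have h2q : (2 : ℚ) ≠ 0 := by norm_num
  rw [padicValRat.div (mul_ne_zero h2q hσ) hDq, padicValRat.mul h2q hσ, padicValRat.of_nat,
    padicValNat.mul (by omega) (by omega), padicValNat_two_odd, add_zero, v2_small.1]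
  have hs := sigmaAtom_two_ge b
  have hv : padicValNat 2 b ≤ b := (padicValNat_le_nat_log b).trans (Nat.log_le_self 2 b)
  have hv' : ((padicValNat 2 b : ℕ) : ℤ) ≤ b := by exact_mod_cast hv
  push_cast at hv' ⊢
  linarith

/-- `v₂(wTerm b) ≥ −3b`. -/
theorem wTerm_two_ge (b : ℕ) : -(3 * (b : ℤ)) ≤ padicValRat 2 (wTerm b) := by
  unfold wTerm
  by_cases hb : b = 0
  · rw [if_pos hb, v2_small.2.2]; subst hb; norm_num
  · rw [if_neg hb]
    have hb1 : 1 ≤ b := Nat.one_le_iff_ne_zero.mpr hb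
    exact le_padicValRat_sub _ _ _ (by linarith) (wInc₁_two_ge b) (wInc₂_two_ge b hb1)

/-- **2-adic atom (W)**: `v₂(W(a)) ≥ −3a`. -/
theorem Watom_two_ge (a : ℕ) : -(3 * (a : ℤ)) ≤ padicValRat 2 (Watom a) := by
  unfold Watom
  apply le_padicValRat_sum _ _ _ (by linarith)
  intro b hb
  rw [Finset.mem_range] at hb
  have h := wTerm_two_ge b
  have : (b : ℤ) ≤ a := by exact_mod_cast hb.le
  linarith

/-- `v_p(2/z) ≥ −⌊log_p B⌋` for an integer `|z| ≤ B`, any prime `p` (`v_p(2) ≥ 0`). -/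
theorem v_two_div_int_ge' {p : ℕ} [Fact p.Prime] (z : ℤ) (B : ℕ) (hz : z.natAbs ≤ B) :
    -(Nat.log p B : ℤ) ≤ padicValRat p (2 / (z : ℚ)) := by
  rcases eq_or_ne z 0 with rfl | hz0
  · simp
  · rw [div_eq_mul_inv, padicValRat.mul two_ne_zero (inv_ne_zero (by exact_mod_cast hz0))]
    have h2 : (0 : ℤ) ≤ padicValRat p (2 : ℚ) := by
      rw [show (2 : ℚ) = ((2 : ℕ) : ℚ) by norm_num, padicValRat.of_nat]; positivity
    have h := v_inv_int_ge (p := p) z B hz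
    linarith

/-- the `Λ` atom at every prime (in particular `p = 2`): `v_p(Λ_a) ≥ −⌊log_p(2(a+J)−1)⌋` (`1 ≤ a ≤ n`, `3n ≤ J`). -/
theorem logDer_padicValRat_ge' {p : ℕ} [Fact p.Prime] (n J a : ℕ) (ha1 : 1 ≤ a) (ha : a ≤ n)
    (hJ : 3 * n ≤ J) :
    -(Nat.log p (2 * (a + J) - 1) : ℤ) ≤ padicValRat p (logDer n J (-(a : ℚ))) := by
  have hk : -(Nat.log p (2 * (a + J) - 1) : ℤ) ≤ 0 := neg_nonpos.mpr (by positivity)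
  unfold logDer
  refine le_padicValRat_sub _ _ _ hk (le_padicValRat_sub _ _ _ hk ?_ ?_) ?_
  · refine le_padicValRat_sum _ _ _ hk (fun i hi => ?_)
    rw [Finset.mem_range] at hi
    rw [show (-(a : ℚ) - J + 1 / 2 + (i : ℕ)) = (((2 * i + 1 - 2 * (a + J) : ℤ)) : ℚ) / 2 by push_cast; ring,
      inv_div]
    exact v_two_div_int_ge' _ _ (by omega)
  · refine le_padicValRat_sum _ _ _ hk (fun i hi => ?_)
    rw [Finset.mem_range] at hi
    rw [show (-(a : ℚ) - J + n + (i : ℕ)) = (((i + n - (a + J) : ℤ)) : ℚ) by push_cast; ring]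
    exact v_inv_int_ge _ _ (by omega)
  · refine le_padicValRat_sum _ _ _ hk (fun e he => ?_)
    rw [Finset.mem_range] at he
    rw [show (-(a : ℚ) + (e : ℕ) + 1) = (((e + 1 - a : ℤ)) : ℚ) by push_cast; ring]
    exact v_inv_int_ge _ _ (by omega)

/-- `J < 2^J`. -/
private theorem lt_two_pow' (J : ℕ) : J < 2 ^ J := by
  induction J with
  | zero => norm_num
  | succ k ih => rw [pow_succ]; omega

/-- the logarithmic loss of `Λ_a` is affordable: `⌊log₂(2(a+J)−1)⌋ ≤ J + 1` (`a ≤ n`, `3n ≤ J`). -/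
theorem log_two_window (n J a : ℕ) (ha : a ≤ n) (hJ : 3 * n ≤ J) : Nat.log 2 (2 * (a + J) - 1) ≤ J + 1 := by
  rcases Nat.eq_zero_or_pos (2 * (a + J) - 1) with h0 | hpos
  · rw [h0]; simp
  · have hJ2 := lt_two_pow' J
    have hM : 2 * (a + J) - 1 < 2 ^ (J + 2) := by rw [pow_succ, pow_succ]; omega
    have := Nat.log_lt_of_lt_pow (by omega) hM
    omega

end Summit.KontsevichZagierPeriods.Zeta5Search.Denom.CatalanRayPClosed
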